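import Literature.Topology.FourManifolds.SurgeredMappingTorus
import HarnessLib

/-!
# Reparametrising the cylinders of a mapping torus by a fibre diffeotopy (flat at the cut)

Fourth brick of the geometric core of R. Gompf, *More Cappell–Shaneson spheres are standard*,
Algebr. Geom. Topol. 10 (2010), Theorem 2.1 / §4 ¶3, towards the named facts
`Literature.Topology.FourManifolds.gompf2010_framedTwist` /
`Literature.Topology.FourManifolds.gompf2010_framedTwistZero`. A variant of the based-isotopy
regluing of `SurgeredMappingTorus.lean` (`isotopyTwistOne/Two`, Gompf §2–3: `X_φ^ε` only depends
on `φ` up to based isotopy) with the *opposite* time profile, which is the one compatible with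
Gompf's tubes: given an open gluing `(T, jA, jB)` of the cylinders `N × (0, 1)`, `N × (1/2, 3/2)`
along `mappingTorusRel C` and a diffeotopy `D = (D_t)` of the fibre `N`, precompose

* the first cylinder with `Literature.Topology.FourManifolds.fibreTwistOne D : (x, s) ↦ (D_{μ s} x, s)`,
  where `μ = Literature.Topology.FourManifolds.startProfile` vanishes for `s ≤ 1/4` and equals `1`
  for `s ≥ 1/2` — so the new coordinates agree with the old ones near the cut `s = 0` and differ
  by `D_1` on the upper half;
* the second cylinder with `Literature.Topology.FourManifolds.fibreTwistTwo C D :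
  (y, t) ↦ (C (D_{μ (t - 1)} (C⁻¹ (D_1 y))), t)`, which is `D_1` for `t ≤ 5/4` and continues the
  first twist across the monodromy overlap.

Then (`Literature.Topology.FourManifolds.IsOpenGluingWith.fibreTwist`) **`(T, jA ∘ fibreTwistOne D,
jB ∘ fibreTwistTwo C D)` is an open gluing along `mappingTorusRel (D_1⁻¹ ∘ C)`**: the same manifold
is a mapping torus of the new monodromy `D_1⁻¹ ∘ C` (`IsOpenGluingWith.fibreTwist_of_eq`: of any
`ψ` with `D_1 = C ∘ ψ⁻¹`). In Gompf's proof of Theorem 2.1 / §4 ¶3 this is applied to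
`T = CSTorus (Δ B)`, `C = Δ B` and the straight-line diffeotopy `D` from `id` to `Δ ∘ δ⁻¹`
(`δ` the Dehn twist, `torusTwistDiffeotopy`): the new monodromy is `δ ∘ B`, and — because `D_t`
is *linear* near the base point and the twist is trivial near `s = 0` — the Gompf tube of `B`
framed by `β`, read in the new coordinates, is again a Gompf tube, of `Δ B` framed by
`s ↦ Δ_{μ} β` (a representative of `β.deltaLeft 1`); that computation is not in this file.
Everything here is generic in the fibre `N`; no named facts are introduced; all declarations
are proved.

## References

* R. E. Gompf, *More Cappell–Shaneson spheres are standard*, Algebr. Geom. Topol. 10 (2010)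
  1665–1681: §2 (`X_φ^ε` up to isotopy rel `p`), §3 ("`δ` is isotopic to `Δ`"), §4 ¶3 (the
  isotopy from `δᵏ` to `Δᵏ` changes the monodromy to `B` and the straightening to `τ·σ`).
  [GompfAGT2010]
* M. W. Hirsch, *Differential Topology*, GTM 33 (1976), Ch. 8 §1 (isotopy, diffeotopy). [HirschDT1976]
-/

open scoped Manifold ContDiff Topology
open Set Function

noncomputable section

namespace Literature.Topology.FourManifolds

/-! ### The time profile: trivial near the cut, full from `s = 1/2` on -/

section Profile

/-- **The start profile** `μ s = smoothTransition (4 s - 1)`: smooth, `μ = 0` on `(-∞, 1/4]` and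
`μ = 1` on `[1/2, ∞)`. [folklore] -/
def startProfile (s : ℝ) : ℝ := Real.smoothTransition (4 * s - 1)

/-- The start profile is smooth. [folklore] -/
theorem contDiff_startProfile : ContDiff ℝ ∞ startProfile :=
  Real.smoothTransition.contDiff.comp ((contDiff_const.mul contDiff_id).sub contDiff_const)

/-- `μ s = 0` for `s ≤ 1/4`. [folklore] -/
theorem startProfile_of_le {s : ℝ} (hs : s ≤ 1 / 4) : startProfile s = 0 := by
  unfold startProfile
  exact Real.smoothTransition.zero_of_nonpos (by linarith)

/-- `μ s = 1` for `1/2 ≤ s`. [folklore] -/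
theorem startProfile_of_ge {s : ℝ} (hs : 1 / 2 ≤ s) : startProfile s = 1 := by
  unfold startProfile
  exact Real.smoothTransition.one_of_one_le (by linarith)

/-- `μ 0 = 0`. [folklore] -/
theorem startProfile_zero : startProfile 0 = 0 := startProfile_of_le (by norm_num)

end Profile

/-! ### The twists of the two cylinders -/

section Twist

variable {EN HN : Type*} [NormedAddCommGroup EN] [NormedSpace ℝ EN] [TopologicalSpace HN]
  {J : ModelWithCorners ℝ EN HN} {N : Type*} [TopologicalSpace N] [ChartedSpace HN N]
  (C : N ≃ₘ⟮J, J⟯ N) (D : Diffeotopy J N)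

/-- **The twist of the first cylinder** `N × (0, 1)` by a fibre diffeotopy `D`:
`(x, s) ↦ (D_{μ s} x, s)` — the identity for `s ≤ 1/4`, `D_1 × id` for `s ≥ 1/2`. [folklore] -/
def fibreTwistOne : (N × ↥mappingTorusPieceOne) ≃ₘ⟮J.prod 𝓘(ℝ, ℝ), J.prod 𝓘(ℝ, ℝ)⟯
    (N × ↥mappingTorusPieceOne) where
  toFun p := (D.toFun (startProfile p.2) p.1, p.2)
  invFun p := (D.invFun (startProfile p.2) p.1, p.2)
  left_inv p := by simp
  right_inv p := by simp
  contMDiff_toFun := by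
    refine ContMDiff.prodMk ?_ contMDiff_snd
    have hl : ContMDiff (J.prod 𝓘(ℝ, ℝ)) 𝓘(ℝ, ℝ) ∞
        fun p : N × ↥mappingTorusPieceOne ↦ startProfile (p.2 : ℝ) :=
      contDiff_startProfile.contMDiff.comp (contMDiff_subtype_val.comp contMDiff_snd)
    exact D.contMDiff_uncurry_toFun.comp (hl.prodMk contMDiff_fst)
  contMDiff_invFun := by
    refine ContMDiff.prodMk ?_ contMDiff_snd
    have hl : ContMDiff (J.prod 𝓘(ℝ, ℝ)) 𝓘(ℝ, ℝ) ∞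
        fun p : N × ↥mappingTorusPieceOne ↦ startProfile (p.2 : ℝ) :=
      contDiff_startProfile.contMDiff.comp (contMDiff_subtype_val.comp contMDiff_snd)
    exact D.contMDiff_uncurry_invFun.comp (hl.prodMk contMDiff_fst)

/-- **The twist of the second cylinder** `N × (1/2, 3/2)`:
`(y, t) ↦ (C (D_{μ (t - 1)} (C⁻¹ (D_1 y))), t)` — equal to `D_1 × id` for `t ≤ 5/4`. [folklore] -/
def fibreTwistTwo : (N × ↥mappingTorusPieceTwo) ≃ₘ⟮J.prod 𝓘(ℝ, ℝ), J.prod 𝓘(ℝ, ℝ)⟯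
    (N × ↥mappingTorusPieceTwo) where
  toFun p := (C (D.toFun (startProfile (p.2 - 1)) (C.symm (D.toFun 1 p.1))), p.2)
  invFun p := (D.invFun 1 (C (D.invFun (startProfile (p.2 - 1)) (C.symm p.1))), p.2)
  left_inv p := by simp
  right_inv p := by simp
  contMDiff_toFun := by
    refine ContMDiff.prodMk ?_ contMDiff_snd
    have hl : ContMDiff (J.prod 𝓘(ℝ, ℝ)) 𝓘(ℝ, ℝ) ∞
        fun p : N × ↥mappingTorusPieceTwo ↦ startProfile ((p.2 : ℝ) - 1) :=
      contDiff_startProfile.contMDiff.comp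
        ((contDiff_id.sub contDiff_const).contMDiff.comp (contMDiff_subtype_val.comp contMDiff_snd))
    have h1 : ContMDiff (J.prod 𝓘(ℝ, ℝ)) J ∞
        fun p : N × ↥mappingTorusPieceTwo ↦ C.symm (D.toFun 1 p.1) :=
      C.symm.contMDiff.comp ((D.contMDiff_toFun 1).comp contMDiff_fst)
    exact C.contMDiff.comp (D.contMDiff_uncurry_toFun.comp (hl.prodMk h1))
  contMDiff_invFun := by
    refine ContMDiff.prodMk ?_ contMDiff_snd
    have hl : ContMDiff (J.prod 𝓘(ℝ, ℝ)) 𝓘(ℝ, ℝ) ∞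
        fun p : N × ↥mappingTorusPieceTwo ↦ startProfile ((p.2 : ℝ) - 1) :=
      contDiff_startProfile.contMDiff.comp
        ((contDiff_id.sub contDiff_const).contMDiff.comp (contMDiff_subtype_val.comp contMDiff_snd))
    have h1 : ContMDiff (J.prod 𝓘(ℝ, ℝ)) J ∞
        fun p : N × ↥mappingTorusPieceTwo ↦ D.invFun (startProfile ((p.2 : ℝ) - 1)) (C.symm p.1) :=
      D.contMDiff_uncurry_invFun.comp (hl.prodMk (C.symm.contMDiff.comp contMDiff_fst))
    exact (D.contMDiff_invFun 1).comp (C.contMDiff.comp h1)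

/-- The value of the first twist (definitional). [folklore] -/
@[simp] theorem fibreTwistOne_apply (p : N × ↥mappingTorusPieceOne) :
    fibreTwistOne D p = (D.toFun (startProfile p.2) p.1, p.2) := rfl

/-- The value of the second twist (definitional). [folklore] -/
@[simp] theorem fibreTwistTwo_apply (p : N × ↥mappingTorusPieceTwo) :
    fibreTwistTwo C D p = (C (D.toFun (startProfile (p.2 - 1)) (C.symm (D.toFun 1 p.1))), p.2) :=
  rfl

/-- Near the cut `s = 0` (for `s ≤ 1/4`) the first twist is the identity. [folklore] -/
theorem fibreTwistOne_apply_of_le {p : N × ↥mappingTorusPieceOne} (hp : (p.2 : ℝ) ≤ 1 / 4) :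
    fibreTwistOne D p = p := by
  rw [fibreTwistOne_apply, startProfile_of_le hp, D.toFun_zero, id]

/-- For `s ≥ 1/2` the first twist is `D_1 × id`. [folklore] -/
theorem fibreTwistOne_apply_of_ge {p : N × ↥mappingTorusPieceOne} (hp : 1 / 2 ≤ (p.2 : ℝ)) :
    fibreTwistOne D p = (D.toFun 1 p.1, p.2) := by
  rw [fibreTwistOne_apply, startProfile_of_ge hp]

/-- For `t ≤ 5/4` the second twist is `D_1 × id`. [folklore] -/
theorem fibreTwistTwo_apply_of_le {p : N × ↥mappingTorusPieceTwo} (hp : (p.2 : ℝ) ≤ 5 / 4) :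
    fibreTwistTwo C D p = (D.toFun 1 p.1, p.2) := by
  rw [fibreTwistTwo_apply, startProfile_of_le (by linarith), D.toFun_zero, id,
    Diffeomorph.apply_symm_apply]

/-- **The twists realise the monodromy `D_1⁻¹ ∘ C`.** For `a = (x, s)`, `b = (y, t)`:
`mappingTorusRel C (Φ₁ a) (Φ₂ b) ↔ mappingTorusRel (D_1⁻¹ ∘ C) a b`. On the identically glued
overlap `t = s ∈ (1/2, 1)` both twists are `D_1`; on the monodromy overlap `t = s + 1`,
`s ∈ (0, 1/2)`, the twists are `D_{μ s}` and `C D_{μ s} C⁻¹ D_1`, and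
`C D_{μ s} C⁻¹ D_1 y = C (D_{μ s} x) ↔ y = D_1⁻¹ (C x)`. [folklore] -/
theorem mappingTorusRel_fibreTwist_iff (a : N × ↥mappingTorusPieceOne)
    (b : N × ↥mappingTorusPieceTwo) :
    mappingTorusRel ⇑C (fibreTwistOne D a) (fibreTwistTwo C D b) ↔
      mappingTorusRel ⇑(C.trans (D.stage 1).symm) a b := by
  obtain ⟨x, s⟩ := a
  obtain ⟨y, t⟩ := b
  have hs := coe_prop_pieceOne s
  have ht := coe_prop_pieceTwo t
  have hinj : ∀ (r : ℝ) (u v : N), D.toFun r u = D.toFun r v → u = v := fun r u v h ↦ by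
    rw [← D.invFun_toFun r u, h, D.invFun_toFun]
  simp only [mappingTorusRel, Diffeomorph.coe_trans, Function.comp_apply, Diffeotopy.coe_stage_symm]
  dsimp only [fibreTwistOne_apply, fibreTwistTwo_apply]
  constructor
  · rintro (⟨hts, hy⟩ | ⟨hts, hy⟩)
    · refine Or.inl ⟨hts, ?_⟩
      have h1 : startProfile ((t : ℝ) - 1) = 0 := startProfile_of_le (by linarith [hs.2])
      have h2 : startProfile (s : ℝ) = 1 := startProfile_of_ge (by linarith [ht.1])
      rw [h1, h2, D.toFun_zero, id, Diffeomorph.apply_symm_apply] at hy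
      exact hinj 1 _ _ hy
    · refine Or.inr ⟨hts, ?_⟩
      rw [hts, add_sub_cancel_right] at hy
      have hy' : C.symm (D.toFun 1 y) = x := hinj _ _ _ (C.injective hy)
      rw [← D.invFun_toFun 1 y, ← C.apply_symm_apply (D.toFun 1 y), hy']
  · rintro (⟨hts, hy⟩ | ⟨hts, hy⟩)
    · refine Or.inl ⟨hts, ?_⟩
      have h1 : startProfile ((t : ℝ) - 1) = 0 := startProfile_of_le (by linarith [hs.2])
      have h2 : startProfile (s : ℝ) = 1 := startProfile_of_ge (by linarith [ht.1])
      rw [h1, h2, D.toFun_zero, id, Diffeomorph.apply_symm_apply, hy]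
    · refine Or.inr ⟨hts, ?_⟩
      rw [hts, add_sub_cancel_right, hy, D.toFun_invFun, Diffeomorph.symm_apply_apply]

/-- The first twist preserves the section `{p₀} × (0, 1)` when the diffeotopy is based at `p₀`. [folklore] -/
theorem image_fibreTwistOne {p₀ : N} (hD : ∀ t, D.toFun t p₀ = p₀) :
    fibreTwistOne D '' ({p₀} ×ˢ univ) = {p₀} ×ˢ univ := by
  ext p
  simp only [mem_image, mem_prod, mem_singleton_iff, mem_univ, and_true]
  constructor
  · rintro ⟨q, hq, rfl⟩
    show D.toFun _ q.1 = p₀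
    rw [hq, hD]
  · intro hp
    exact ⟨p, hp, Prod.ext (show D.toFun _ p.1 = p.1 by rw [hp, hD]) rfl⟩

/-- The second twist preserves the section `{p₀} × (1/2, 3/2)` when the diffeotopy is based at
`p₀` and `C p₀ = p₀`. [folklore] -/
theorem image_fibreTwistTwo {p₀ : N} (hC : C p₀ = p₀) (hD : ∀ t, D.toFun t p₀ = p₀) :
    fibreTwistTwo C D '' ({p₀} ×ˢ univ) = {p₀} ×ˢ univ := by
  have hC' : C.symm p₀ = p₀ := C.symm_apply_eq_self_of_apply_eq_self hC
  ext p
  simp only [mem_image, mem_prod, mem_singleton_iff, mem_univ, and_true]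
  constructor
  · rintro ⟨q, hq, rfl⟩
    show C (D.toFun _ (C.symm (D.toFun 1 q.1))) = p₀
    rw [hq, hD, hC', hD, hC]
  · intro hp
    exact ⟨p, hp, Prod.ext (show C (D.toFun _ (C.symm (D.toFun 1 p.1))) = p.1 by
      rw [hp, hD, hC', hD, hC]) rfl⟩

end Twist

/-! ### Transfer of the open gluing -/

section Transfer

variable {EN HN : Type*} [NormedAddCommGroup EN] [NormedSpace ℝ EN] [TopologicalSpace HN]
  {J : ModelWithCorners ℝ EN HN} {N : Type*} [TopologicalSpace N] [ChartedSpace HN N]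
  [IsManifold J ∞ N]
  {EP HP : Type*} [NormedAddCommGroup EP] [NormedSpace ℝ EP] [TopologicalSpace HP]
  {IP : ModelWithCorners ℝ EP HP} {T : Type*} [TopologicalSpace T] [ChartedSpace HP T]
  (C : N ≃ₘ⟮J, J⟯ N) (D : Diffeotopy J N)
  {jA : N × ↥mappingTorusPieceOne → T} {jB : N × ↥mappingTorusPieceTwo → T}

/-- **Reparametrising the cylinders by a fibre diffeotopy changes the monodromy to `D_1⁻¹ ∘ C`.**
If `(T, jA, jB)` is an open gluing of `N × (0, 1)` and `N × (1/2, 3/2)` along `mappingTorusRel C`,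
then `(T, jA ∘ fibreTwistOne D, jB ∘ fibreTwistTwo C D)` is an open gluing along
`mappingTorusRel (D_1⁻¹ ∘ C)` — the same manifold as a mapping torus of a based-isotopic
monodromy, in coordinates which are unchanged near the cut `s = 0` (Gompf 2010, §4 ¶3: "Our
isotopy from `δᵏ` to `Δᵏ` changes the bundle monodromy to `B`"). [cite: GompfAGT2010, §4 ¶3 (the isotopy from δ^k to Δ^k changes the monodromy to B)] -/
theorem IsOpenGluingWith.fibreTwist
    (h : IsOpenGluingWith (J.prod 𝓘(ℝ, ℝ)) (J.prod 𝓘(ℝ, ℝ)) IP (mappingTorusRel ⇑C) jA jB) :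
    IsOpenGluingWith (J.prod 𝓘(ℝ, ℝ)) (J.prod 𝓘(ℝ, ℝ)) IP
      (mappingTorusRel ⇑(C.trans (D.stage 1).symm)) (jA ∘ fibreTwistOne D)
      (jB ∘ fibreTwistTwo C D) := by
  obtain ⟨hA, hAo, hB, hBo, hU, hR⟩ := h
  have hsA : Function.Surjective (fibreTwistOne D) := (fibreTwistOne D).surjective
  have hsB : Function.Surjective (fibreTwistTwo C D) := (fibreTwistTwo C D).surjective
  refine ⟨hA.comp_diffeomorph _, ?_, hB.comp_diffeomorph _, ?_, ?_, fun a b ↦ ?_⟩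
  · rwa [hsA.range_comp]
  · rwa [hsB.range_comp]
  · rwa [hsA.range_comp, hsB.range_comp]
  · rw [Function.comp_apply, Function.comp_apply, hR]
    exact mappingTorusRel_fibreTwist_iff C D a b

/-- **Realising a prescribed monodromy.** If moreover `D_1 = C ∘ ψ⁻¹` (so `D_1⁻¹ ∘ C = ψ`), the
twisted embeddings glue along `mappingTorusRel ψ`. [cite: GompfAGT2010, §4 ¶3 (the isotopy from δ^k to Δ^k changes the monodromy to B)] -/
theorem IsOpenGluingWith.fibreTwist_of_eq
    (h : IsOpenGluingWith (J.prod 𝓘(ℝ, ℝ)) (J.prod 𝓘(ℝ, ℝ)) IP (mappingTorusRel ⇑C) jA jB)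
    (ψ : N ≃ₘ⟮J, J⟯ N) (hD1 : ∀ x, D.toFun 1 x = C (ψ.symm x)) :
    IsOpenGluingWith (J.prod 𝓘(ℝ, ℝ)) (J.prod 𝓘(ℝ, ℝ)) IP (mappingTorusRel ⇑ψ)
      (jA ∘ fibreTwistOne D) (jB ∘ fibreTwistTwo C D) := by
  have heq : (⇑(C.trans (D.stage 1).symm) : N → N) = ⇑ψ := by
    funext x
    rw [Diffeomorph.coe_trans, Function.comp_apply, Diffeotopy.coe_stage_symm]
    have h1 : D.toFun 1 (ψ x) = C x := by rw [hD1, Diffeomorph.symm_apply_apply]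
    rw [← h1, D.invFun_toFun]
  rw [← heq]
  exact h.fibreTwist C D

omit [IsManifold J ∞ N] [TopologicalSpace T] [ChartedSpace HP T] in
/-- The section circle is unchanged: the twisted embeddings have the same images of the
sections `{p₀} × (0, 1)`, `{p₀} × (1/2, 3/2)` when `C` and `D` are based at `p₀`. [folklore] -/
theorem image_fibreTwist_sections {p₀ : N} (hC : C p₀ = p₀) (hD : ∀ t, D.toFun t p₀ = p₀) :
    (jA ∘ fibreTwistOne D) '' ({p₀} ×ˢ univ) ∪ (jB ∘ fibreTwistTwo C D) '' ({p₀} ×ˢ univ) =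
      jA '' ({p₀} ×ˢ univ) ∪ jB '' ({p₀} ×ˢ univ) := by
  rw [Set.image_comp, Set.image_comp, image_fibreTwistOne D hD, image_fibreTwistTwo C D hC hD]

end Transfer

end Literature.Topology.FourManifolds
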